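import Literature.NumberTheory.GaloisRepresentations.SUnitsLayerInvariantVector
import Literature.NumberTheory.GaloisRepresentations.SUnitsCoinducedKummerLayer
import HarnessLib

/-!
# The `Δ`-class of `𝓗²(E_S)[p]`: `ψ(𝓗²(E_S)[p]) + ψ(ℤ/p) = ψ(ℤ[S(E)]/p)` from a layer presentation of the
# right-action module `𝓗²(E_S) = H²(U, Maps(U⧸W, E_S))` (NSW (8.3.11): `H²(G_S, 𝒪_S^×)(p) ≅ ker(⊕_{v∈S} ℚ_p/ℤ_p →Σ ℚ_p/ℤ_p)`)

Topic `NumberTheory/GaloisRepresentations`; namespace `Literature.NumberTheory.GaloisRepresentations.SUnits.Layers`.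
One hypothesis structure (`LayerPresentation`, data + properties of the layer maps — CONVENTIONS §9 "prefer a hypothesis
structure") and theorems; NO named fact, no `sorry`, no instance, no notation.  Lane «TATE-EPC-TC» of cell `bsd-eis`
(crux `GoodLatticeBDPValue`, stmt-BirchSwinnertonDyer-19032), FILE D part 2: the DISCHARGE of the hypothesis `hH2` of
-w4 g17's FILE C (`TateEulerCharacteristicKummerClasses`) modulo the layer presentation (θ-i)-top of -w2 g9.

SETTING (FILE B/C): `K` totally complex, `S ⊇ S_p` finite, `H ≤ Γ_K` open with `N_S ≤ H`, `U = galoisGroupAbove S H`,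
`F₀ = baseField H`, `E : GalLayer K` with `F₀ ≤ E.1 ⊆ K_S`, `W = layerSubgroup … E` (= `Gal(K_S/E)`), `Δ = ↥U ⧸ W`,
`𝓗² = H²(↥U, Maps(Δ, E_S))` with `Δ` acting by `coindOpenHRep` (right translations).

A LAYER PRESENTATION of `𝓗²` (`LayerPresentation`) is, for every bigger layer `E′ ≥ E` inside `K_S`, an additive map
`L_{E′} : H²(Gal(E′/E), 𝒪_{E′,S}ˣ) → 𝓗²` (group `↥E′.1 ≃ₐ[↥E.1] ↥E′.1`, module `SUnits.sUnitsRep K S ↥E.1 ↥E′.1`), compatible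
with inflation (`layerInf`), jointly surjective, with kernel killed by a further inflation, and carrying Serre's
`σ_t` (`sUnitsConj`, `t ∈ Gal(E′/F₀)`) to the right translation by the image of `t` in `Δ` — Shapiro's lemma for the open
`W` followed by the layer description of `H²(W, E_S)` (NSW VIII §3; -w2 g9's (θ-i)-top supplies the instance).

THEOREM `additive_torsion_coindOpenHRep_two_of_layerPresentation` (= `hH2`): for every additive invariant `ψ` of finite
`p`-torsion `ℤ[Δ]`-modules (B3a-β binders) and every `Δ`-stable `N₂ = 𝓗²[p]`,
`ψ(N₂) + ψ(ℤ/p) = ψ(ℤ[placesAbove K S F₀ E]/p ∘ layerEquiv)`.  Proof: the invariant vector `θ` (FILE D part 1,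
`invVec`) of a layer representative is well defined on `𝓗²` (compatibility with inflation), additive, `Δ`-equivariant for
the permutation action on the places of `E` above `S` (`invVec_sUnitsConj` + the action axiom), injective
(`exists_layerInf_eq_of_invVec_eq` + the kernel axiom), sum-zero (`sum_invVec_eq_zero`), and ONTO the sum-zero `p`-torsion
families (-w8's REALISATION `exists_layer_realisation` over the cyclotomic layer `exists_cyclotomicLayer`); then -w6 g10's
package `additive_permutation_quotient_comp_eq_add_trivial_of_embedding_sumZero` with `T = (ℚ/ℤ)[p]`.

HONEST FRAMING: bookkeeping of landed theorems; no statement of a Summit, of Tate's theorem or of the crux is proved here;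
0 cells / labels / tiers move.

## References
* J. Neukirch, A. Schmidt, K. Wingberg, *Cohomology of Number Fields*, 2nd ed. (2008), VIII §3 (8.3.10)–(8.3.11), I §6.
  [NeukirchSchmidtWingberg2008]
* J. W. S. Cassels, A. Fröhlich (eds.), *Algebraic Number Theory* (1967), Ch. VII (Tate) §7.3, §11.2. [CasselsFrohlichANT1967]
* J. S. Milne, *Arithmetic Duality Theorems* (2006), I §5, proof of Thm. 5.1. [MilneADT2006]
-/

noncomputable section

open NumberField IsDedekindDomain Field IntermediateField CategoryTheory groupCohomology Function
open Literature.NumberTheory.GaloisRepresentations.OpenSubgroupLayer (algOfLE isScalarTower_algOfLE baseField)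
open Literature.NumberTheory.GaloisRepresentations.LocalWeilDatum
open Literature.NumberTheory.GaloisRepresentations.IdeleClassBar (GalLayer)
open Literature.NumberTheory.IwasawaTheory.Greenberg2006 (galoisGroupAbove)
open Literature.NumberTheory.NumberFields (EquivariantSUnit.placesAbove EquivariantSUnit.finite_placesAbove)
open Literature.RepresentationTheory.FiniteGroups.StableLatticeReduction (smul_top_le_comap)

namespace Literature.NumberTheory.GaloisRepresentations

namespace SUnits

namespace Layers

variable {K : Type} [Field K] [NumberField K] {S : Set (HeightOneSpectrum (𝓞 K))} {H : Subgroup (absoluteGaloisGroup K)}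

/-! ## §1. The objects and the layer presentation -/

/-- The layer subgroup `W = Gal(K_S/E) ≤ ↥U` as a bare subgroup (FILE B's token). [cite: NeukirchSchmidtWingberg2008, VIII §3] -/
abbrev layerW (hHo : IsOpen (H : Set (absoluteGaloisGroup K))) (E : GalLayer K) (hF : baseField H ≤ E.1)
    (hS : ramificationSubgroup K S ≤ galFixing K E.1) : Subgroup ↥(galoisGroupAbove S H) :=
  ((OpenSubgroupLayer.layerSubgroup S hHo E hF hS : OpenNormalSubgroup ↥(galoisGroupAbove S H)) : Subgroup ↥(galoisGroupAbove S H))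

/-- `W` is open. [cite: NeukirchSchmidtWingberg2008, VIII §3] -/
theorem isOpen_layerW (hHo : IsOpen (H : Set (absoluteGaloisGroup K))) (E : GalLayer K) (hF : baseField H ≤ E.1)
    (hS : ramificationSubgroup K S ≤ galFixing K E.1) : IsOpen (layerW hHo E hF hS : Set ↥(galoisGroupAbove S H)) :=
  (OpenSubgroupLayer.layerSubgroup S hHo E hF hS).isOpen'

/-- **`𝓗² = H²(↥U, Maps(↥U ⧸ W, E_S))`**, the right-action model (FILE B's token). [cite: NeukirchSchmidtWingberg2008, I §6 (1.6.4)] -/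
abbrev coindH2 [CompactSpace ↥(galoisGroupAbove S H)] (hHo : IsOpen (H : Set (absoluteGaloisGroup K))) (E : GalLayer K)
    (hF : baseField H ≤ E.1) (hS : ramificationSubgroup K S ≤ galFixing K E.1) : Type :=
  continuousCohomology 2 ((resRep K S H).coindOpen (layerW hHo E hF hS) (isOpen_layerW hHo E hF hS)).toTopRep

/-- **A layer presentation of `𝓗²`**: additive maps `L_{E′} : H²(Gal(E′/E), 𝒪_{E′,S}ˣ) → 𝓗²` for the layers `E′ ≥ E`
inside `K_S`, compatible with inflation, jointly surjective, with kernel killed by a further inflation, and carrying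
`σ_t` to the right translation by `t|_E` (Shapiro + the layer description of `H²(W, E_S)`; the instance is -w2 g9's
(θ-i)-top). [cite: NeukirchSchmidtWingberg2008, VIII §3, I §6 (1.6.4)–(1.6.5)][cite: SerreGaloisCohomology1997, I §2.2 Prop. 8, §2.5] -/
structure LayerPresentation [CompactSpace ↥(galoisGroupAbove S H)] (hHo : IsOpen (H : Set (absoluteGaloisGroup K)))
    (E : GalLayer K) (hF : baseField H ≤ E.1) (hS : ramificationSubgroup K S ≤ galFixing K E.1) where
  /-- (a) the layer map at a layer `E′ ≥ E` inside `K_S` -/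
  toCoind : ∀ (E' : GalLayer K) (hEE' : E ≤ E') (_ : ramificationSubgroup K S ≤ galFixing K E'.1),
    (letI := algOfLE (show E.1 ≤ E'.1 from hEE'); groupCohomology (sUnitsRep K S ↥E.1 ↥E'.1) 2) →+ coindH2 hHo E hF hS
  /-- (b) compatibility with inflation -/
  toCoind_layerInf : ∀ (E' E'' : GalLayer K) (hEE' : E ≤ E') (hE'E'' : E' ≤ E'')
    (hS' : ramificationSubgroup K S ≤ galFixing K E'.1) (hS'' : ramificationSubgroup K S ≤ galFixing K E''.1)
    (c : letI := algOfLE (show E.1 ≤ E'.1 from hEE'); groupCohomology (sUnitsRep K S ↥E.1 ↥E'.1) 2),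
    haveI := E'.isGalois; haveI := E'.finiteDimensional; haveI := E''.isGalois; haveI := E''.finiteDimensional
    toCoind E'' (hEE'.trans hE'E'') hS'' (layerInf S (show E.1 ≤ E'.1 from hEE') (show E'.1 ≤ E''.1 from hE'E'') 2 c) =
      toCoind E' hEE' hS' c
  /-- (c) joint surjectivity -/
  exists_eq : ∀ y : coindH2 hHo E hF hS, ∃ (E' : GalLayer K) (hEE' : E ≤ E')
    (hS' : ramificationSubgroup K S ≤ galFixing K E'.1)
    (c : letI := algOfLE (show E.1 ≤ E'.1 from hEE'); groupCohomology (sUnitsRep K S ↥E.1 ↥E'.1) 2), toCoind E' hEE' hS' c = y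
  /-- (d) the kernel is killed by a further inflation -/
  exists_layerInf_eq_zero : ∀ (E' : GalLayer K) (hEE' : E ≤ E') (hS' : ramificationSubgroup K S ≤ galFixing K E'.1)
    (c : letI := algOfLE (show E.1 ≤ E'.1 from hEE'); groupCohomology (sUnitsRep K S ↥E.1 ↥E'.1) 2),
    toCoind E' hEE' hS' c = 0 → ∃ (E'' : GalLayer K) (hE'E'' : E' ≤ E'') (_ : ramificationSubgroup K S ≤ galFixing K E''.1),
      haveI := E'.isGalois; haveI := E'.finiteDimensional; haveI := E''.isGalois; haveI := E''.finiteDimensional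
      layerInf S (show E.1 ≤ E'.1 from hEE') (show E'.1 ≤ E''.1 from hE'E'') 2 c = 0
  /-- (e) the action: `R_d ∘ L_{E′} = L_{E′} ∘ σ_t` whenever `d = t|_E` -/
  coindOpenHRep_toCoind : ∀ (E' : GalLayer K) (hEE' : E ≤ E') (hS' : ramificationSubgroup K S ≤ galFixing K E'.1)
    (t : letI := algOfLE (hF.trans (show E.1 ≤ E'.1 from hEE')); ↥E'.1 ≃ₐ[↥(baseField H)] ↥E'.1)
    (d : ↥(galoisGroupAbove S H) ⧸ layerW hHo E hF hS),
    (letI := algOfLE hF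
     letI := algOfLE (show E.1 ≤ E'.1 from hEE')
     letI := algOfLE (hF.trans (show E.1 ≤ E'.1 from hEE'))
     haveI := isScalarTower_algOfLE₃ hF (show E.1 ≤ E'.1 from hEE')
     haveI := E.isGalois
     haveI := normal_algOfLE (K := K) hF
     OpenSubgroupLayer.layerEquiv S hHo E hF hS d = t.restrictNormal ↥E.1) →
    ∀ c : (letI := algOfLE (show E.1 ≤ E'.1 from hEE'); groupCohomology (sUnitsRep K S ↥E.1 ↥E'.1) 2),
      (resRep K S H).coindOpenHRep (layerW hHo E hF hS) (isOpen_layerW hHo E hF hS) 2 d (toCoind E' hEE' hS' c) =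
        toCoind E' hEE' hS'
          (letI := algOfLE hF
           letI := algOfLE (show E.1 ≤ E'.1 from hEE')
           letI := algOfLE (hF.trans (show E.1 ≤ E'.1 from hEE'))
           haveI := isScalarTower_algOfLE₃ hF (show E.1 ≤ E'.1 from hEE')
           haveI := E.isGalois
           haveI := normal_algOfLE (K := K) hF
           sUnitsConj ↥(baseField H) ↥E.1 ↥E'.1 S t 2 c)

/-! ## §2. The invariant vector on `𝓗²`: well defined, additive, equivariant, injective, sum-zero, onto -/

section Theta

variable [CompactSpace ↥(galoisGroupAbove S H)] {hHo : IsOpen (H : Set (absoluteGaloisGroup K))} {E : GalLayer K}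
  {hF : baseField H ≤ E.1} {hS : ramificationSubgroup K S ≤ galFixing K E.1} (L : LayerPresentation hHo E hF hS)
  (S_E : Finset (HeightOneSpectrum (𝓞 ↥E.1))) (hSE : ∀ u : HeightOneSpectrum (𝓞 ↥E.1), u ∈ S_E ↔ u.under (𝓞 K) ∈ S)

omit [NumberField K] in
/-- `N_S ≤ Gal(K̄/(E′ ⊔ E″))` for two layers inside `K_S`. [cite: NeukirchSchmidtWingberg2008, VIII §3] -/
theorem ramificationSubgroup_le_galFixing_sup {E' E'' : GalLayer K} (hS' : ramificationSubgroup K S ≤ galFixing K E'.1)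
    (hS'' : ramificationSubgroup K S ≤ galFixing K E''.1) :
    ramificationSubgroup K S ≤ galFixing K (GalLayer.sup E' E'').1 := by
  change ramificationSubgroup K S ≤ galFixing K (E'.1 ⊔ E''.1)
  rw [galFixing_sup]
  exact le_inf hS' hS''

/-- The layer of a chosen representative of `y ∈ 𝓗²`. [cite: NeukirchSchmidtWingberg2008, VIII §3 (8.3.11)] -/
def LayerPresentation.repLayer (y : coindH2 hHo E hF hS) : GalLayer K := (L.exists_eq y).choose

/-- The chosen layer contains `E`. [cite: NeukirchSchmidtWingberg2008, VIII §3 (8.3.11)] -/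
theorem LayerPresentation.le_repLayer (y : coindH2 hHo E hF hS) : E ≤ L.repLayer y := (L.exists_eq y).choose_spec.choose

/-- The chosen layer lies in `K_S`. [cite: NeukirchSchmidtWingberg2008, VIII §3 (8.3.11)] -/
theorem LayerPresentation.ramificationSubgroup_le_repLayer (y : coindH2 hHo E hF hS) :
    ramificationSubgroup K S ≤ galFixing K (L.repLayer y).1 :=
  (L.exists_eq y).choose_spec.choose_spec.choose

/-- The chosen representative class at the chosen layer. [cite: NeukirchSchmidtWingberg2008, VIII §3 (8.3.11)] -/
def LayerPresentation.repClass (y : coindH2 hHo E hF hS) :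
    (letI := algOfLE (show E.1 ≤ (L.repLayer y).1 from L.le_repLayer y)
     groupCohomology (sUnitsRep K S ↥E.1 ↥(L.repLayer y).1) 2) :=
  (L.exists_eq y).choose_spec.choose_spec.choose_spec.choose

/-- The chosen representative represents. [cite: NeukirchSchmidtWingberg2008, VIII §3 (8.3.11)] -/
theorem LayerPresentation.toCoind_repClass (y : coindH2 hHo E hF hS) :
    L.toCoind (L.repLayer y) (L.le_repLayer y) (L.ramificationSubgroup_le_repLayer y) (L.repClass y) = y :=
  (L.exists_eq y).choose_spec.choose_spec.choose_spec.choose_spec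

/-- **The invariant vector on `𝓗²`**: `θ(y) := θ_{E′}(c)` for the chosen representative `L_{E′} c = y`
(`invVec` of FILE D part 1; independence of the choice is `coindInvVec_eq`).
[cite: NeukirchSchmidtWingberg2008, VIII §3 (8.3.11)][cite: CasselsFrohlichANT1967, Ch. VII §7.3 Cor. 7.4 (b)] -/
def LayerPresentation.coindInvVec (y : coindH2 hHo E hF hS) : HeightOneSpectrum (𝓞 ↥E.1) → AddCircle (1 : ℚ) :=
  haveI := E.numberField
  haveI := (L.repLayer y).finiteDimensional
  haveI := (L.repLayer y).isGalois
  invVec S (show E.1 ≤ (L.repLayer y).1 from L.le_repLayer y) S_E hSE (L.repClass y)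

/-- **Two classes of the SAME layer with the same image in `𝓗²` have the same invariant vector** (their difference is
killed by a further inflation, which does not change invariant vectors). [cite: NeukirchSchmidtWingberg2008, VIII §3 (8.3.11)] -/
theorem LayerPresentation.invVec_eq_of_toCoind_eq {E' : GalLayer K} (hEE' : E ≤ E')
    (hS' : ramificationSubgroup K S ≤ galFixing K E'.1)
    (c c' : letI := algOfLE (show E.1 ≤ E'.1 from hEE'); groupCohomology (sUnitsRep K S ↥E.1 ↥E'.1) 2)
    (h : L.toCoind E' hEE' hS' c = L.toCoind E' hEE' hS' c') :
    haveI := E.numberField; haveI := E'.finiteDimensional; haveI := E'.isGalois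
    invVec S (show E.1 ≤ E'.1 from hEE') S_E hSE c = invVec S (show E.1 ≤ E'.1 from hEE') S_E hSE c' := by
  haveI := E.numberField
  haveI := E'.finiteDimensional
  haveI := E'.isGalois
  have h0 : L.toCoind E' hEE' hS' (c - c') = 0 := by rw [map_sub, h, sub_self]
  obtain ⟨E'', hE'E'', hS'', hz⟩ := L.exists_layerInf_eq_zero E' hEE' hS' (c - c') h0
  haveI := E''.finiteDimensional
  haveI := E''.isGalois
  rw [map_sub, sub_eq_zero] at hz
  rw [← invVec_layerInf S (show E.1 ≤ E'.1 from hEE') S_E hSE (show E'.1 ≤ E''.1 from hE'E'') c,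
    ← invVec_layerInf S (show E.1 ≤ E'.1 from hEE') S_E hSE (show E'.1 ≤ E''.1 from hE'E'') c', hz]

/-- **`θ` is independent of the representative**: `θ(L_{E′} c) = θ_{E′}(c)` for EVERY layer `E′` and class `c`
(move both representatives to the compositum, compare there). [cite: NeukirchSchmidtWingberg2008, VIII §3 (8.3.11)] -/
theorem LayerPresentation.coindInvVec_eq {E' : GalLayer K} (hEE' : E ≤ E') (hS' : ramificationSubgroup K S ≤ galFixing K E'.1)
    (c : letI := algOfLE (show E.1 ≤ E'.1 from hEE'); groupCohomology (sUnitsRep K S ↥E.1 ↥E'.1) 2) :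
    L.coindInvVec S_E hSE (L.toCoind E' hEE' hS' c) =
      (haveI := E.numberField; haveI := E'.finiteDimensional; haveI := E'.isGalois
       invVec S (show E.1 ≤ E'.1 from hEE') S_E hSE c) := by
  haveI := E.numberField
  haveI := E'.finiteDimensional
  haveI := E'.isGalois
  -- the chosen representative `(E₁, c₁)` of `y := L_{E′} c` and the compositum `E₃ = E₁ ⊔ E′`
  generalize hy : L.toCoind E' hEE' hS' c = y
  have h₁ := L.le_repLayer y
  have hS₁ := L.ramificationSubgroup_le_repLayer y
  haveI := (L.repLayer y).finiteDimensional
  haveI := (L.repLayer y).isGalois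
  have h₁₃ : L.repLayer y ≤ GalLayer.sup (L.repLayer y) E' := le_sup_left (a := (L.repLayer y).1) (b := E'.1)
  have h'₃ : E' ≤ GalLayer.sup (L.repLayer y) E' := le_sup_right (a := (L.repLayer y).1) (b := E'.1)
  have hS₃ := ramificationSubgroup_le_galFixing_sup hS₁ hS'
  haveI := (GalLayer.sup (L.repLayer y) E').finiteDimensional
  haveI := (GalLayer.sup (L.repLayer y) E').isGalois
  -- both inflations to `E₃` represent `y`
  have key : L.toCoind _ (h₁.trans h₁₃) hS₃
        (layerInf S (show E.1 ≤ (L.repLayer y).1 from h₁) (show (L.repLayer y).1 ≤ (GalLayer.sup (L.repLayer y) E').1 from h₁₃)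
          2 (L.repClass y)) =
      L.toCoind _ (hEE'.trans h'₃) hS₃
        (layerInf S (show E.1 ≤ E'.1 from hEE') (show E'.1 ≤ (GalLayer.sup (L.repLayer y) E').1 from h'₃) 2 c) := by
    rw [L.toCoind_layerInf _ _ h₁ h₁₃ hS₁ hS₃, L.toCoind_layerInf _ _ hEE' h'₃ hS' hS₃, L.toCoind_repClass y, hy]
  have h3 := L.invVec_eq_of_toCoind_eq S_E hSE (h₁.trans h₁₃) hS₃ _ _ key
  rw [invVec_layerInf, invVec_layerInf] at h3
  rw [LayerPresentation.coindInvVec]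
  exact h3


/-- **`θ` is additive.** [cite: CasselsFrohlichANT1967, Ch. VII §7.3] -/
theorem LayerPresentation.coindInvVec_add (y y' : coindH2 hHo E hF hS) :
    L.coindInvVec S_E hSE (y + y') = L.coindInvVec S_E hSE y + L.coindInvVec S_E hSE y' := by
  haveI := E.numberField
  -- representatives at a common layer
  have h₁ := L.le_repLayer y
  have h₂ := L.le_repLayer y'
  have hS₁ := L.ramificationSubgroup_le_repLayer y
  have hS₂ := L.ramificationSubgroup_le_repLayer y'
  haveI := (L.repLayer y).finiteDimensional
  haveI := (L.repLayer y).isGalois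
  haveI := (L.repLayer y').finiteDimensional
  haveI := (L.repLayer y').isGalois
  have h₁₃ : L.repLayer y ≤ GalLayer.sup (L.repLayer y) (L.repLayer y') :=
    le_sup_left (a := (L.repLayer y).1) (b := (L.repLayer y').1)
  have h₂₃ : L.repLayer y' ≤ GalLayer.sup (L.repLayer y) (L.repLayer y') :=
    le_sup_right (a := (L.repLayer y).1) (b := (L.repLayer y').1)
  have hS₃ := ramificationSubgroup_le_galFixing_sup hS₁ hS₂
  haveI := (GalLayer.sup (L.repLayer y) (L.repLayer y')).finiteDimensional
  haveI := (GalLayer.sup (L.repLayer y) (L.repLayer y')).isGalois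
  have hsum : L.toCoind _ (h₁.trans h₁₃) hS₃
      (layerInf S (show E.1 ≤ (L.repLayer y).1 from h₁)
          (show (L.repLayer y).1 ≤ (GalLayer.sup (L.repLayer y) (L.repLayer y')).1 from h₁₃) 2 (L.repClass y) +
        layerInf S (show E.1 ≤ (L.repLayer y').1 from h₂)
          (show (L.repLayer y').1 ≤ (GalLayer.sup (L.repLayer y) (L.repLayer y')).1 from h₂₃) 2 (L.repClass y')) =
      y + y' := by
    rw [map_add, L.toCoind_layerInf _ _ h₁ h₁₃ hS₁ hS₃, L.toCoind_layerInf _ _ h₂ h₂₃ hS₂ hS₃, L.toCoind_repClass,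
      L.toCoind_repClass]
  rw [← hsum, L.coindInvVec_eq, invVec_add, invVec_layerInf, invVec_layerInf, ← L.coindInvVec_eq S_E hSE h₁ hS₁,
    ← L.coindInvVec_eq S_E hSE h₂ hS₂, L.toCoind_repClass, L.toCoind_repClass]

/-- `θ(0) = 0`. [cite: CasselsFrohlichANT1967, Ch. VII §7.3] -/
theorem LayerPresentation.coindInvVec_zero : L.coindInvVec S_E hSE 0 = 0 := by
  haveI := E.numberField
  haveI := E.finiteDimensional
  haveI := E.isGalois
  have h := L.coindInvVec_eq S_E hSE (le_refl E) hS 0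
  rwa [map_zero, invVec_zero] at h

/-- **`θ` as an additive homomorphism `𝓗² →+ (places of E → ℚ/ℤ)`.** [cite: CasselsFrohlichANT1967, Ch. VII §7.3] -/
def LayerPresentation.coindInvVecHom : coindH2 hHo E hF hS →+ (HeightOneSpectrum (𝓞 ↥E.1) → AddCircle (1 : ℚ)) where
  toFun := L.coindInvVec S_E hSE
  map_zero' := L.coindInvVec_zero S_E hSE
  map_add' := L.coindInvVec_add S_E hSE

/-- Unfolding `coindInvVecHom`. [cite: CasselsFrohlichANT1967, Ch. VII §7.3] -/
@[simp] theorem LayerPresentation.coindInvVecHom_apply (y : coindH2 hHo E hF hS) :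
    L.coindInvVecHom S_E hSE y = L.coindInvVec S_E hSE y := rfl

/-- **`θ` is injective on `𝓗²`** (`K` totally complex): equal invariant vectors at a common layer force equal
inflations in a bigger layer (FILE D part 1), hence equal images. [cite: NeukirchSchmidtWingberg2008, VIII §3 (8.3.11) (ii)/(iii)] -/
theorem LayerPresentation.coindInvVec_injective [IsTotallyComplex K] : Injective (L.coindInvVec S_E hSE) := by
  intro y y' h
  haveI := E.numberField
  have h₁ := L.le_repLayer y
  have h₂ := L.le_repLayer y'
  have hS₁ := L.ramificationSubgroup_le_repLayer y
  have hS₂ := L.ramificationSubgroup_le_repLayer y'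
  haveI := (L.repLayer y).finiteDimensional
  haveI := (L.repLayer y).isGalois
  haveI := (L.repLayer y').finiteDimensional
  haveI := (L.repLayer y').isGalois
  have h₁₃ : L.repLayer y ≤ GalLayer.sup (L.repLayer y) (L.repLayer y') :=
    le_sup_left (a := (L.repLayer y).1) (b := (L.repLayer y').1)
  have h₂₃ : L.repLayer y' ≤ GalLayer.sup (L.repLayer y) (L.repLayer y') :=
    le_sup_right (a := (L.repLayer y).1) (b := (L.repLayer y').1)
  have hS₃ := ramificationSubgroup_le_galFixing_sup hS₁ hS₂
  haveI := (GalLayer.sup (L.repLayer y) (L.repLayer y')).finiteDimensional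
  haveI := (GalLayer.sup (L.repLayer y) (L.repLayer y')).isGalois
  -- the two representatives, inflated to the common layer, have the same invariant vector
  have hv : invVec S (show E.1 ≤ (GalLayer.sup (L.repLayer y) (L.repLayer y')).1 from h₁.trans h₁₃) S_E hSE
        (layerInf S (show E.1 ≤ (L.repLayer y).1 from h₁)
          (show (L.repLayer y).1 ≤ (GalLayer.sup (L.repLayer y) (L.repLayer y')).1 from h₁₃) 2 (L.repClass y)) =
      invVec S (show E.1 ≤ (GalLayer.sup (L.repLayer y) (L.repLayer y')).1 from h₁.trans h₁₃) S_E hSE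
        (layerInf S (show E.1 ≤ (L.repLayer y').1 from h₂)
          (show (L.repLayer y').1 ≤ (GalLayer.sup (L.repLayer y) (L.repLayer y')).1 from h₂₃) 2 (L.repClass y')) := by
    rw [invVec_layerInf, invVec_layerInf, ← L.coindInvVec_eq S_E hSE h₁ hS₁, ← L.coindInvVec_eq S_E hSE h₂ hS₂,
      L.toCoind_repClass, L.toCoind_repClass, h]
  obtain ⟨E₄, hfd₄, hgal₄, h₃₄, hS₄, h4⟩ := exists_layerInf_eq_of_invVec_eq S _ S_E hSE hS₃ _ _ hv
  -- apply `L` at the layer `E₄`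
  let E₄' : GalLayer K := ⟨E₄, hfd₄, hgal₄⟩
  have h₃₄' : GalLayer.sup (L.repLayer y) (L.repLayer y') ≤ E₄' := h₃₄
  have key := congrArg (L.toCoind E₄' ((h₁.trans h₁₃).trans h₃₄') hS₄) h4
  rw [L.toCoind_layerInf _ E₄' (h₁.trans h₁₃) h₃₄' hS₃ hS₄, L.toCoind_layerInf _ E₄' (h₁.trans h₁₃) h₃₄' hS₃ hS₄,
    L.toCoind_layerInf _ _ h₁ h₁₃ hS₁ hS₃, L.toCoind_layerInf _ _ h₂ h₂₃ hS₂ hS₃, L.toCoind_repClass,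
    L.toCoind_repClass] at key
  exact key

/-- **`θ(y)` vanishes off `S_E`.** [cite: CasselsFrohlichANT1967, Ch. VII §7.3 Cor. 7.4] -/
theorem LayerPresentation.coindInvVec_eq_zero_of_not_mem (y : coindH2 hHo E hF hS) {w : HeightOneSpectrum (𝓞 ↥E.1)}
    (hw : w ∉ S_E) : L.coindInvVec S_E hSE y w = 0 := by
  haveI := E.numberField
  haveI := (L.repLayer y).finiteDimensional
  haveI := (L.repLayer y).isGalois
  exact invVec_eq_zero_of_not_mem S _ S_E hSE (L.ramificationSubgroup_le_repLayer y) _ hw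

/-- **`Σ_{w ∈ S_E} θ(y)(w) = 0`** (`K` totally complex). [cite: NeukirchSchmidtWingberg2008, VIII §3 (8.3.10)–(8.3.11)] -/
theorem LayerPresentation.sum_coindInvVec_eq_zero [IsTotallyComplex K] (y : coindH2 hHo E hF hS) :
    ∑ w ∈ S_E, L.coindInvVec S_E hSE y w = 0 := by
  haveI := E.numberField
  haveI := (L.repLayer y).finiteDimensional
  haveI := (L.repLayer y).isGalois
  exact sum_invVec_eq_zero S _ S_E hSE (L.ramificationSubgroup_le_repLayer y) _

set_option maxHeartbeats 400000 in
/-- **`θ` is `Δ`-equivariant**: `θ(R_d y)(w) = θ(y)((layerEquiv d)⁻¹ w)` (the action axiom of the presentation, a lift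
`t ∈ Gal(E′/F₀)` of `layerEquiv d`, and `invVec_sUnitsConj`). [cite: CasselsFrohlichANT1967, Ch. VII §1.1, §7.3]
[cite: SerreLocalFields1979, Ch. VII §5] -/
theorem LayerPresentation.coindInvVec_coindOpenHRep (d : ↥(galoisGroupAbove S H) ⧸ layerW hHo E hF hS)
    (y : coindH2 hHo E hF hS) (w : HeightOneSpectrum (𝓞 ↥E.1)) :
    L.coindInvVec S_E hSE ((resRep K S H).coindOpenHRep (layerW hHo E hF hS) (isOpen_layerW hHo E hF hS) 2 d y) w =
      L.coindInvVec S_E hSE y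
        ((letI := algOfLE hF; OpenSubgroupLayer.layerEquiv S hHo E hF hS d)⁻¹ • w) := by
  haveI := E.numberField
  haveI := E.isGalois
  letI := algOfLE hF
  have h₁ := L.le_repLayer y
  have hS₁ := L.ramificationSubgroup_le_repLayer y
  haveI := (L.repLayer y).finiteDimensional
  haveI := (L.repLayer y).isGalois
  letI := algOfLE (show E.1 ≤ (L.repLayer y).1 from h₁)
  letI := algOfLE (hF.trans (show E.1 ≤ (L.repLayer y).1 from h₁))
  haveI := isScalarTower_algOfLE₃ hF (show E.1 ≤ (L.repLayer y).1 from h₁)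
  haveI := normal_algOfLE (K := K) hF
  haveI := normal_algOfLE (K := K) (hF.trans (show E.1 ≤ (L.repLayer y).1 from h₁))
  haveI : NumberField ↥(baseField H) :=
    haveI : FiniteDimensional K ↥(baseField H) :=
      FiniteDimensional.of_injective (IntermediateField.inclusion hF).toLinearMap (IntermediateField.inclusion hF).injective
    NumberField.of_module_finite K _
  -- a lift `t` of `layerEquiv d` to `Gal(E₁/F₀)`
  obtain ⟨t, ht⟩ := AlgEquiv.restrictNormalHom_surjective (F := ↥(baseField H)) (E := ↥(L.repLayer y).1) (K₁ := ↥E.1)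
    (OpenSubgroupLayer.layerEquiv S hHo E hF hS d)
  have hact := L.coindOpenHRep_toCoind (L.repLayer y) h₁ hS₁ t d ht.symm (L.repClass y)
  rw [L.toCoind_repClass] at hact
  rw [hact, L.coindInvVec_eq, invVec_sUnitsConj S _ S_E hSE hF t, ← L.coindInvVec_eq S_E hSE h₁ hS₁, L.toCoind_repClass]
  change _ = L.coindInvVec S_E hSE y ((OpenSubgroupLayer.layerEquiv S hHo E hF hS d)⁻¹ • w)
  rw [← ht]
  rfl

/-- If `(p : ℤ) • y = 0` then `(p : ℤ) • θ(y) = 0`. [cite: NeukirchSchmidtWingberg2008, VIII §3 (8.3.11)] -/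
theorem LayerPresentation.zsmul_coindInvVec_eq_zero {p : ℕ} (y : coindH2 hHo E hF hS) (hy : (p : ℤ) • y = 0) :
    (p : ℤ) • L.coindInvVec S_E hSE y = 0 := by
  rw [← L.coindInvVecHom_apply, ← map_zsmul, hy, map_zero]

end Theta


end Layers

end SUnits

end Literature.NumberTheory.GaloisRepresentations

end
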